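import Mathlib
import Literature.MathematicalPhysics.QuantumFieldTheory.Balaban1983to89.B10Eq71Concrete
import Literature.MathematicalPhysics.QuantumFieldTheory.Balaban1983to89.B10Eq69Local
import Summits.QuantumFields.Balaban3D.Proofs.CouplingWindow
import Summits.QuantumFields.Balaban3D.Proofs.Thresholds

/-!
# `Summit.QuantumFields.Balaban3D.Proofs.PerPlaquette71` — lane «pub-balaban3d» (Bałaban, CMP **102** (1985) 255–275, d = 3
# lattice UV stability AS PRINTED), prover seat p2: the per-plaquette small factor **(67)–(71)** p. 273 ALONG A RUN —
# the hypotheses of the 4D cell's concrete theorem `B10Eq71Concrete.smallFactor_specialUnitary` discharged from the ONE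
# regularity sentence (44) p. 267 L1–2 at step `k` and ONE coupling threshold

HONEST FRAMING (lane PLAN.md §0, binding).  [B10] = [Balaban1985UV3]: UV stability of the d = 3 Wilson lattice gauge theory on
a finite torus; NOT a continuum limit, NOT d = 4, NOT the Clay problem.  Nothing of the paper is asserted; this is
kernel-checked BOOKKEEPING about the 4D cell's concrete `ℤ³` objects (`B7Prop2Explicit.avgIter` = the `j`-fold average (42)
of [4] = [Balaban1985Averaging], `SU(N)`-valued configurations, operator norm), to be INSTANTIATED at the lane's `run3`.

THE PRINTED TEXT (p. 273 = PDF 19, render `…/1985-cmp102-uv-stability-3d/…-p019-x2.png`, L18–29; (67)–(71) quoted in full in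
`…B10Eq70Squaring`): *«Let us take a plaquette p′ ⊂ Λ_j and such that |V_j(∂p′) − 1| ≥ g_jp(g_j). We have (67) Ū_k^j = V_j on
Λ_j, and the configuration U_k satisfies the following regularity condition on B^j(Λ_j): |U_k(∂p) − 1| < O(1)g_jp(g_j)L^{−2j}
(68). … (1/g_k²) Σ_{p⊂Δ′} η⁻¹[1 − Re tr U_k(∂p)] ≥ … ≥ ¼p²(g_j) (71) for g_j sufficiently small.»*

WHAT IS PROVED HERE (re-derived bookkeeping; no content of the series):
* §1 (moved to `…Proofs.CouplingWindow`): the coupling arithmetic on the printed flow `g_i = g(L^iε)^{1/2}` (`gRun_sq_scale`: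
  `g_k² = g_j²L^{k−j}`; `gRun_pred_scale_sq_le`: `g_{k−1}·(L^jη)² ≤ g_j` for `j < k`; `pFun_antitone`);
* §4 `perPlaquette71_local`(`_gamma`) — the LOCAL form AS PRINTED ((68) only on `Δ′ ⊂ B^j(Λ_j)`; the 4D cell's
  `B10Eq69Local.smallFactor_of_largeField_concrete`, `G = U(N) ⊇ SU(N)`), thresholds `Thresholds.sigma68`/`gamma71L` — the form the
  lane's `run3` should instantiate (the regularity of the composite minimizer is local).
* §2 `perPlaquette71_run` — **(68) from (44)**: the regularity of `U_k` printed before (44) p. 267 L1–2, *«|U_k(∂p) − 1| <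
  2L²B₃g_{k−1}p(g_{k−1})η²»* (read on all of `ηℤ³`, model note (M1) of `B10Eq44AvgRegularity`), IS the regularity (68) at every
  scale `j < k` with `O(1) = 2L²B₃` (because `g_{k−1}p(g_{k−1})(L^jη)² ≤ g_jp(g_j)`: §1), so the per-plaquette bound (71)
  holds for every large-field plaquette `p′` of scale `j < k` under: the `SU(N)` lift `U` of `U_k`, the regularity at step
  `k`, the large-field condition *«|V_j(∂p′) − 1| ≥ g_jp(g_j)»* transported by (67) to `Ū_k^j`, and ONE scale-free coupling
  threshold `g_ip(g_i) ≤ σ` (`i = j, k−1`) with five explicit inequalities on `σ` — conclusion in the form consumed by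
  `…Proofs.LargeFieldKnit.smallFactorsAll_of_perPlaquette`: *«¼p²(g_j) ≤ N·(g_k⁻²·Σ_{p⊂Δ′} η⁻¹[1 − Re tr U_k(∂p)])»*, `N` the
  trace-normalisation factor of cell DIVERGENCE D-b10.1, `Re tr = N⁻¹Re Tr`.
-/

noncomputable section

open scoped BigOperators Matrix.Norms.L2Operator

namespace Summit.QuantumFields.Balaban3D.Proofs.PerPlaquette71

open Literature.MathematicalPhysics.QuantumFieldTheory.Balaban1983to89
open B7Prop1Explicit (Site hol plaqWord)
open B7Prop2Explicit (pdev avgIter C0 c2')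
open B7Prop2SpecialUnitary (specialUnitaryUnits)
open B10Eq70Squaring (deltaBox)
open Summit.QuantumFields.Balaban3D.Proofs.CouplingWindow (gRun_sq_scale gRun_le_of_le gRun_pred_scale_sq_le pFun_antitone)
open Finset

/-! ## §1 Coupling arithmetic along the flow: see `…Proofs.CouplingWindow` (`gRun_sq_scale`, `gRun_le_of_le`,
`gRun_pred_scale_sq_le`, `pFun_antitone`) -/


/-! ## §2 (68) ⇒ (71) along a run, from the step-`k` regularity (44) and one coupling threshold -/

section PerPlaquette

variable {n : Type} [Fintype n] [DecidableEq n] [Nonempty n]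

/-- **(67)–(71) p. 273 for every large-field plaquette of scale `j < k`, from the step-`k` data.**  Couplings on the printed
flow `g_i = g(L^iε)^{1/2}` (`hrun`) with `g_{k−1} ≤ 1`; ONE threshold `g_ip(g_i) ≤ σ` at `i = j` and `i = k − 1` with
`σ ≤ 1` and the explicit inequalities `hσ₁`–`hσ₃` (Prop. 2 of [4] for `α₀ ≤ 2L²B₃σ` and the `SU(N)` closure radius
`N·32(d+1)(d+4)L²α₀ < π`), `hσ₅` ((71)'s «for g_j sufficiently small» with `O(1) = C₁ = 2L²B₃`, `C₂ = (16/3)C₀C₁²`); the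
`SU(N)`-valued fine configuration `U` (the lift of `U_k`) with the regularity printed before (44) p. 267, *«|U_k(∂p) − 1| <
2L²B₃g_{k−1}p(g_{k−1})η²»*, `η = L^{−k}` (`hreg`, all of `ηℤ³`); the large-field condition of `p′` (the level-`j` plaquette at
`z₀` spanned by `e_μ, e_ν`) transported by (67) *«Ū_k^j = V_j on Λ_j»* to `|Ū_k^j(∂p′) − 1| ≥ g_jp(g_j)` (`hLF`).  THEN (71) in
the form *«¼p²(g_j) ≤ N·(g_k⁻²·Σ_{p⊂Δ′}η⁻¹[1 − Re tr U_k(∂p)])»* (`η⁻¹ = L^k`, `Re tr = N⁻¹Re Tr`; `Δ′ = deltaBox`, the four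
`j`-blocks at the corners of `p′`).  Proof: `B10Eq71Concrete.smallFactor_specialUnitary` with `α₀ = 2L²B₃g_{k−1}p(g_{k−1})(L^jη)²`,
`C₁ = 2L²B₃`; the hypotheses `h68`/`hαε` are the step-`k` regularity and §1.  Re-derived bookkeeping. [cite: Balaban1985UV3, (67)–(71) p.273] -/
theorem perPlaquette71_run (L : ℕ) (hL : 2 ≤ L) {gb ε b₀ p₀ B₃ σ : ℝ} (hgb : 0 < gb) (hε : 0 < ε) (hb₀ : 0 < b₀)
    (hp₀ : 0 ≤ p₀) (hB : 0 < B₃) (g : ℕ → ℝ) (hrun : ∀ i, g i = B10.gRun gb L ε i)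
    {j k : ℕ} (hjk : j < k) (hgk1 : g (k - 1) ≤ 1)
    (hs_k : g (k - 1) * B10.pFun b₀ p₀ (g (k - 1)) ≤ σ) (hs_j : g j * B10.pFun b₀ p₀ (g j) ≤ σ) (hσ1 : σ ≤ 1)
    (hσ₁ : C0 3 * (2 * (L : ℝ) ^ 2 * B₃ * σ) ≤ 1 / 3)
    (hσ₂ : 2 * (2 * (L : ℝ) ^ 2 * B₃ * σ) ≤ c2' 3 L)
    (hσ₃ : Fintype.card n * (32 * ((3 : ℝ) + 1) * (3 + 4) * (L : ℝ) ^ 2 * (2 * (L : ℝ) ^ 2 * B₃ * σ)) < Real.pi)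
    (hσ₅ : (2 * (2 * (L : ℝ) ^ 2 * B₃) * (16 / 3 * C0 3 * (2 * (L : ℝ) ^ 2 * B₃) ^ 2) +
        (16 / 3 * C0 3 * (2 * (L : ℝ) ^ 2 * B₃) ^ 2) ^ 2) / 2 * σ ≤ 1 / 4)
    (U : Site 3 → Fin 3 → (Matrix n n ℂ)ˣ) (hU : ∀ x κ, U x κ ∈ specialUnitaryUnits n)
    (hreg : pdev U < 2 * (L : ℝ) ^ 2 * B₃ * (g (k - 1) * B10.pFun b₀ p₀ (g (k - 1))) * (((L : ℝ) ^ k)⁻¹) ^ 2)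
    (z₀ : Site 3) {μ ν : Fin 3} (hμν : μ ≠ ν)
    (hLF : g j * B10.pFun b₀ p₀ (g j) ≤
      ‖((hol (avgIter L U j) z₀ (plaqWord μ ν) : (Matrix n n ℂ)ˣ) : Matrix n n ℂ) - 1‖) :
    B10.pFun b₀ p₀ (g j) ^ 2 / 4 ≤
      Fintype.card n * ((g k)⁻¹ ^ 2 * ∑ y ∈ deltaBox (L ^ j) ((L ^ j : ℕ) • z₀) μ ν,
        (L : ℝ) ^ k * (1 - (Fintype.card n : ℝ)⁻¹ *
          (((hol U y (plaqWord μ ν) : (Matrix n n ℂ)ˣ) : Matrix n n ℂ).trace.re))) := by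
  -- letters
  have hLr1 : (1 : ℝ) ≤ L := by exact_mod_cast le_trans (by norm_num) hL
  have hLr0 : (0 : ℝ) ≤ L := by linarith
  set sk : ℝ := g (k - 1) * B10.pFun b₀ p₀ (g (k - 1)) with hsk_def
  set sj : ℝ := g j * B10.pFun b₀ p₀ (g j) with hsj_def
  set ℓ : ℝ := (L : ℝ) ^ j * ((L : ℝ) ^ k)⁻¹ with hℓ_def
  have hgj : 0 < g j := by rw [hrun]; exact B10.gRun_pos gb L ε hgb (by linarith) hε j
  have hgk0 : 0 < g (k - 1) := by rw [hrun]; exact B10.gRun_pos gb L ε hgb (by linarith) hε (k - 1)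
  have hgjk : g j ≤ g (k - 1) := by
    rw [hrun, hrun]; exact gRun_le_of_le gb L ε hgb.le hLr1 hε.le (by omega)
  have hgj1 : g j ≤ 1 := hgjk.trans hgk1
  have hpj : 0 ≤ B10.pFun b₀ p₀ (g j) := B10.pFun_nonneg b₀ p₀ (g j) hb₀.le hgj hgj1
  have hpk : 0 < B10.pFun b₀ p₀ (g (k - 1)) := by
    unfold B10.pFun
    have hu := B10.log_inv_nonneg_of_le_one hgk0 hgk1
    exact mul_pos hb₀ (Real.rpow_pos_of_pos (by linarith) _)
  have hsk0 : 0 < sk := mul_pos hgk0 hpk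
  have hℓ0 : 0 < ℓ := by positivity
  have hℓ1 : ℓ ^ 2 ≤ 1 := by
    have hle : (L : ℝ) ^ j ≤ (L : ℝ) ^ k := pow_le_pow_right₀ hLr1 hjk.le
    have hpos : (0 : ℝ) < (L : ℝ) ^ k := by positivity
    have h1 : ℓ ≤ 1 := by
      rw [hℓ_def, mul_inv_le_iff₀ hpos, one_mul]; exact hle
    exact pow_le_one₀ hℓ0.le h1
  -- the regularity radius α₀ = 2L²B₃·s_k·ℓ² and the smallness of [4] Prop. 2 for it
  set α₀ : ℝ := 2 * (L : ℝ) ^ 2 * B₃ * sk * ℓ ^ 2 with hα₀_def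
  have hα : 0 < α₀ := by positivity
  have hα_le : α₀ ≤ 2 * (L : ℝ) ^ 2 * B₃ * σ := by
    have h2 : 0 ≤ 2 * (L : ℝ) ^ 2 * B₃ := by positivity
    calc α₀ = 2 * (L : ℝ) ^ 2 * B₃ * (sk * ℓ ^ 2) := by rw [hα₀_def]; ring
      _ ≤ 2 * (L : ℝ) ^ 2 * B₃ * (σ * 1) := by
          refine mul_le_mul_of_nonneg_left ?_ h2
          exact mul_le_mul hs_k hℓ1 (sq_nonneg _) (hsk0.le.trans hs_k)
      _ = 2 * (L : ℝ) ^ 2 * B₃ * σ := by ring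
  have hα3 : C0 3 * α₀ ≤ 1 / 3 :=
    (mul_le_mul_of_nonneg_left hα_le (B7Prop2Explicit.C0_pos 3).le).trans hσ₁
  have hα2 : 2 * α₀ ≤ c2' 3 L := by linarith
  have hαN : Fintype.card n * (32 * ((3 : ℝ) + 1) * (3 + 4) * (L : ℝ) ^ 2 * α₀) < Real.pi := by
    refine lt_of_le_of_lt ?_ hσ₃
    have h32 : 0 ≤ (Fintype.card n : ℝ) * (32 * ((3 : ℝ) + 1) * (3 + 4) * (L : ℝ) ^ 2) := by positivity
    nlinarith
  -- (68) at scale j IS the step-k regularity: α₀·(L^j)⁻² = 2L²B₃s_k·η²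
  have h68 : pdev U < α₀ * (((L : ℝ) ^ j)⁻¹) ^ 2 := by
    have hid : α₀ * (((L : ℝ) ^ j)⁻¹) ^ 2 = 2 * (L : ℝ) ^ 2 * B₃ * sk * (((L : ℝ) ^ k)⁻¹) ^ 2 := by
      rw [hα₀_def, hℓ_def]
      have hj0 : (L : ℝ) ^ j ≠ 0 := by positivity
      field_simp
    rw [hid]
    exact hreg
  -- α₀ ≤ C₁·g_jp(g_j) with C₁ = 2L²B₃, because s_k·ℓ² ≤ g_jp(g_j)
  have hαε : α₀ ≤ 2 * (L : ℝ) ^ 2 * B₃ * (g j * B10.pFun b₀ p₀ (g j)) := by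
    have h2 : 0 ≤ 2 * (L : ℝ) ^ 2 * B₃ := by positivity
    have hcmp : sk * ℓ ^ 2 ≤ g j * B10.pFun b₀ p₀ (g j) := by
      have hstep1 : g (k - 1) * ℓ ^ 2 ≤ g j := by
        rw [hrun, hrun, hℓ_def]
        exact gRun_pred_scale_sq_le gb L ε hgb.le hLr1 hε.le hjk
      have hstep2 : B10.pFun b₀ p₀ (g (k - 1)) ≤ B10.pFun b₀ p₀ (g j) :=
        pFun_antitone hb₀.le hp₀ hgj hgjk hgk1
      calc sk * ℓ ^ 2 = (g (k - 1) * ℓ ^ 2) * B10.pFun b₀ p₀ (g (k - 1)) := by rw [hsk_def]; ring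
        _ ≤ g j * B10.pFun b₀ p₀ (g j) := mul_le_mul hstep1 hstep2 hpk.le hgj.le
    calc α₀ = 2 * (L : ℝ) ^ 2 * B₃ * (sk * ℓ ^ 2) := by rw [hα₀_def]; ring
      _ ≤ 2 * (L : ℝ) ^ 2 * B₃ * (g j * B10.pFun b₀ p₀ (g j)) := mul_le_mul_of_nonneg_left hcmp h2
  -- g_k² = g_j²L^{k−j}
  have hgk : g k ^ 2 = g j ^ 2 * (L : ℝ) ^ (k - j) := by
    rw [hrun, hrun]; exact gRun_sq_scale gb L ε hLr0 hε.le hjk.le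
  -- «for g_j sufficiently small» of (71)
  have hsmall : (2 * (2 * (L : ℝ) ^ 2 * B₃) * (16 / 3 * C0 3 * (2 * (L : ℝ) ^ 2 * B₃) ^ 2) +
      (16 / 3 * C0 3 * (2 * (L : ℝ) ^ 2 * B₃) ^ 2) ^ 2) / 2 * g j * B10.pFun b₀ p₀ (g j) ≤ 1 / 4 := by
    have hK : 0 ≤ (2 * (2 * (L : ℝ) ^ 2 * B₃) * (16 / 3 * C0 3 * (2 * (L : ℝ) ^ 2 * B₃) ^ 2) +
        (16 / 3 * C0 3 * (2 * (L : ℝ) ^ 2 * B₃) ^ 2) ^ 2) / 2 := by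
      have := (B7Prop2Explicit.C0_pos 3).le
      positivity
    calc _ = (2 * (2 * (L : ℝ) ^ 2 * B₃) * (16 / 3 * C0 3 * (2 * (L : ℝ) ^ 2 * B₃) ^ 2) +
          (16 / 3 * C0 3 * (2 * (L : ℝ) ^ 2 * B₃) ^ 2) ^ 2) / 2 * sj := by rw [hsj_def]; ring
      _ ≤ _ * σ := mul_le_mul_of_nonneg_left hs_j hK
      _ ≤ 1 / 4 := hσ₅
  have key := B10Eq71Concrete.smallFactor_specialUnitary L hL j k hjk.le U hU z₀ hμν
    (gj := g j) (gk := g k) (p := B10.pFun b₀ p₀ (g j)) (α₀ := α₀) (C₁ := 2 * (L : ℝ) ^ 2 * B₃)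
    hgj hgk hpj (hs_j.trans hσ1) hα hα3 hα2 hαN h68 hαε hLF hsmall
  -- rewrite the localized action in the normalized form
  have hre : (g k ^ 2)⁻¹ * ((L : ℝ) ^ k * ∑ y ∈ deltaBox (L ^ j) ((L ^ j : ℕ) • z₀) μ ν,
        (Fintype.card n : ℝ) * (1 - (Fintype.card n : ℝ)⁻¹ *
          (((hol U y (plaqWord μ ν) : (Matrix n n ℂ)ˣ) : Matrix n n ℂ).trace.re)))
      = Fintype.card n * ((g k)⁻¹ ^ 2 * ∑ y ∈ deltaBox (L ^ j) ((L ^ j : ℕ) • z₀) μ ν,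
        (L : ℝ) ^ k * (1 - (Fintype.card n : ℝ)⁻¹ *
          (((hol U y (plaqWord μ ν) : (Matrix n n ℂ)ˣ) : Matrix n n ℂ).trace.re))) := by
    rw [Finset.mul_sum, Finset.mul_sum, Finset.mul_sum, Finset.mul_sum]
    refine Finset.sum_congr rfl fun y _ => ?_
    rw [inv_pow]
    ring
  rw [← hre]
  exact key

end PerPlaquette

/-! ## §3 EXPORT (lead ruling R-EPS0′): (71) per plaquette from ONE named threshold `g_i ≤ γ₇₁` -/

section Export

open Summit.QuantumFields.Balaban3D.Proofs.Thresholds (sigma71 gamma71 sigma71_spec sigma71_pos gamma71_spec)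

variable {n : Type} [Fintype n] [DecidableEq n] [Nonempty n]

/-- **(67)–(71) per large-field plaquette with the coupling side CLOSED** (R-EPS0′): as `perPlaquette71_run`, the six
`σ`-premises discharged from `g_{k−1} ≤ γ₇₁(L, N, B₃, b₀, p₀)` and `g_j ≤ γ₇₁` (`Thresholds.gamma71`; along the flow
`g_j ≤ g_{k−1}`, so the first suffices — both are kept for readability).  Remaining hypotheses: the `SU(N)` lift with the
step-`k` regularity (44) p. 267 L1–2 (binder b11) and the transported large-field condition `hLF` ((67) + the history).
[cite: Balaban1985UV3, (67)–(71) p.273] -/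
theorem perPlaquette71_gamma (L : ℕ) (hL : 2 ≤ L) {gb ε b₀ p₀ B₃ : ℝ} (hgb : 0 < gb) (hε : 0 < ε) (hb₀ : 0 < b₀)
    (hp₀ : 0 < p₀) (hB : 0 < B₃) (g : ℕ → ℝ) (hrun : ∀ i, g i = B10.gRun gb L ε i)
    {j k : ℕ} (hjk : j < k) (hgk1 : g (k - 1) ≤ 1)
    (hγk : g (k - 1) ≤ gamma71 L (Fintype.card n) B₃ b₀ p₀) (hγj : g j ≤ gamma71 L (Fintype.card n) B₃ b₀ p₀)
    (U : Site 3 → Fin 3 → (Matrix n n ℂ)ˣ) (hU : ∀ x κ, U x κ ∈ specialUnitaryUnits n)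
    (hreg : pdev U < 2 * (L : ℝ) ^ 2 * B₃ * (g (k - 1) * B10.pFun b₀ p₀ (g (k - 1))) * (((L : ℝ) ^ k)⁻¹) ^ 2)
    (z₀ : Site 3) {μ ν : Fin 3} (hμν : μ ≠ ν)
    (hLF : g j * B10.pFun b₀ p₀ (g j) ≤
      ‖((hol (avgIter L U j) z₀ (plaqWord μ ν) : (Matrix n n ℂ)ˣ) : Matrix n n ℂ) - 1‖) :
    B10.pFun b₀ p₀ (g j) ^ 2 / 4 ≤
      Fintype.card n * ((g k)⁻¹ ^ 2 * ∑ y ∈ deltaBox (L ^ j) ((L ^ j : ℕ) • z₀) μ ν,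
        (L : ℝ) ^ k * (1 - (Fintype.card n : ℝ)⁻¹ *
          (((hol U y (plaqWord μ ν) : (Matrix n n ℂ)ˣ) : Matrix n n ℂ).trace.re))) := by
  have hL1 : 1 ≤ L := le_trans (by norm_num) hL
  have hLr0 : (0 : ℝ) < L := by exact_mod_cast lt_of_lt_of_le (by norm_num) hL
  have hN1 : 1 ≤ Fintype.card n := Fintype.card_pos
  have hgpos : ∀ i, 0 < g i := fun i => by rw [hrun]; exact B10.gRun_pos gb L ε hgb hLr0 hε i
  have hs_k := gamma71_spec hL1 hN1 hB hb₀ hp₀ (hgpos (k - 1)) hγk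
  have hs_j := gamma71_spec hL1 hN1 hB hb₀ hp₀ (hgpos j) hγj
  have hσ := sigma71_spec (σ := sigma71 L (Fintype.card n) B₃) hL1 hN1 hB le_rfl
  exact perPlaquette71_run L hL hgb hε hb₀ hp₀.le hB g hrun hjk hgk1 hs_k hs_j hσ.1 hσ.2.1 hσ.2.2.1 hσ.2.2.2.1
    hσ.2.2.2.2 U hU hreg z₀ hμν hLF

end Export

/-! ## §4 The LOCAL form: (68) only on `Δ′ ⊂ B^j(Λ_j)`, as printed (`B10Eq69Local`), `G = U(N) ⊇ SU(N)` -/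

section LocalForm

open scoped Matrix.Norms.L2Operator
open B7Prop1Local (pdevOn loK plaqHiK)
open B7Prop2Explicit (unitaryUnits)
open Summit.QuantumFields.Balaban3D.Proofs.Thresholds (sigma68 gamma71L K71L K71L_pos sigma68_spec sigma68_pos
  gamma71L_spec gamma71L_pos_le)

variable {N : ℕ} [NeZero N]

/-- **(67)–(71) per large-field plaquette, LOCAL HYPOTHESES AS PRINTED** (p. 273 L19–21: *«We have (67) Ū_k^j = V_j on Λ_j, and
the configuration U_k satisfies the following regularity condition on B^j(Λ_j). |U_k(∂p) − 1| < O(1)g_jp(q_j)L^{−2j} ⟦sic: p(g_j)⟧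
(68)»*): the 4D cell's `B10Eq69Local.smallFactor_of_largeField_concrete` ((69), (70), the (11)-comparison DISCHARGED there) with
its coupling premises reduced to ONE scale-free threshold `g_jp(g_j) ≤ σ ≤ sigma68 C₁ L` (`Thresholds.sigma68`; `C₁` = the
`O(1)` of (68)).  Hypotheses left, all printed or structural: the `U(N)`-valued lift `U` of `U_k` (SU(N) ⊂ U(N)), a configuration
`Vj` with **(67)** `Ū^j(∂p′) = V_j(∂p′)` at the large-field plaquette `p′ = (z₀; μ, ν)` and the large-field condition
`|V_j(∂p′) − 1| ≥ g_jp(g_j)`, **(68)** on the unit plaquettes of `Δ′ = B^j(x₀) ∪ ⋯ ∪ B^j(w₀)` ONLY (`pdevOn (loK L j z₀)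
(plaqHiK L j z₀ μ ν)`), the flow `g_i = g(L^iε)^{1/2}` (`g_k² = g_j²L^{k−j}`), `0 < g_j ≤ 1`.  Conclusion in the shape
`LargeFieldKnit.smallFactorsAll_of_perPlaquette` consumes (`N` = trace-normalisation factor, DIVERGENCE D-b10.1). [cite: Balaban1985UV3, (67)–(71) p.273] -/
theorem perPlaquette71_local (L : ℕ) (hL : 2 ≤ L) {gb ε b₀ p₀ C₁ σ : ℝ} (hgb : 0 < gb) (hε : 0 < ε) (hb₀ : 0 < b₀)
    (hC₁ : 0 < C₁) (g : ℕ → ℝ) (hrun : ∀ i, g i = B10.gRun gb L ε i) {j k : ℕ} (hjk : j ≤ k) (hgj1 : g j ≤ 1)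
    (hs_j : g j * B10.pFun b₀ p₀ (g j) ≤ σ) (hσ : σ ≤ sigma68 C₁ L)
    (U Vj : Site 3 → Fin 3 → (Matrix (Fin N) (Fin N) ℂ)ˣ) (hU : ∀ x κ, U x κ ∈ unitaryUnits (Matrix (Fin N) (Fin N) ℂ))
    (z₀ : Site 3) {μ ν : Fin 3} (hμν : μ ≠ ν)
    (h67 : hol (avgIter L U j) z₀ (plaqWord μ ν) = hol Vj z₀ (plaqWord μ ν))
    (hLF : g j * B10.pFun b₀ p₀ (g j) ≤ ‖((hol Vj z₀ (plaqWord μ ν) : (Matrix (Fin N) (Fin N) ℂ)ˣ) : Matrix (Fin N) (Fin N) ℂ) - 1‖)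
    (h68 : pdevOn (loK L j z₀) (plaqHiK L j z₀ μ ν) U < C₁ * (g j * B10.pFun b₀ p₀ (g j)) * (((L : ℝ) ^ j)⁻¹) ^ 2) :
    B10.pFun b₀ p₀ (g j) ^ 2 / 4 ≤
      (N : ℝ) * ((g k)⁻¹ ^ 2 * ∑ y ∈ deltaBox (L ^ j) ((L ^ j : ℕ) • z₀) μ ν,
        (L : ℝ) ^ k * (1 - (N : ℝ)⁻¹ *
          (((hol U y (plaqWord μ ν) : (Matrix (Fin N) (Fin N) ℂ)ˣ) : Matrix (Fin N) (Fin N) ℂ).trace.re))) := by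
  have hL1 : 1 ≤ L := le_trans (by norm_num) hL
  have hLr0 : (0 : ℝ) ≤ L := by exact_mod_cast (Nat.zero_le L)
  have hLr : (0 : ℝ) < L := by exact_mod_cast lt_of_lt_of_le (by norm_num) hL
  have hgj : 0 < g j := by rw [hrun]; exact B10.gRun_pos gb L ε hgb hLr hε j
  have hpj : 0 < B10.pFun b₀ p₀ (g j) := by
    unfold B10.pFun
    have hu := B10.log_inv_nonneg_of_le_one hgj hgj1
    exact mul_pos hb₀ (Real.rpow_pos_of_pos (by linarith) _)
  set sj : ℝ := g j * B10.pFun b₀ p₀ (g j) with hsj_def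
  have hsj0 : 0 < sj := mul_pos hgj hpj
  have hspec := sigma68_spec hC₁ hσ
  -- monotonicity `s_j ≤ σ`
  have hα3 : C0 3 * (C₁ * sj) ≤ 1 / 3 := by
    have := mul_le_mul_of_nonneg_left (mul_le_mul_of_nonneg_left hs_j hC₁.le) (B7Prop2Explicit.C0_pos 3).le
    exact this.trans hspec.1
  have hα2 : 2 * (C₁ * sj) ≤ c2' 3 L := by nlinarith [hspec.2.1]
  have hgp : sj ≤ 1 := hs_j.trans hspec.2.2.1
  have hsmall : (2 * C₁ * (6 * C0 3 * C₁ ^ 2) + (6 * C0 3 * C₁ ^ 2) ^ 2) / 2 * g j * B10.pFun b₀ p₀ (g j) ≤ 1 / 4 := by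
    have hK := (K71L_pos hC₁).le
    calc _ = K71L C₁ * sj := by rw [hsj_def]; unfold K71L; ring
      _ ≤ K71L C₁ * σ := mul_le_mul_of_nonneg_left hs_j hK
      _ ≤ 1 / 4 := hspec.2.2.2
  have hgk : g k ^ 2 = g j ^ 2 * (L : ℝ) ^ (k - j) := by
    rw [hrun, hrun]; exact gRun_sq_scale gb L ε hLr0 hε.le hjk
  have key := B10Eq69Local.smallFactor_of_largeField_concrete L hL j k hjk U Vj hU z₀ hμν (gj := g j) (gk := g k)
    (p := B10.pFun b₀ p₀ (g j)) (C₁ := C₁) hgj hgk hpj hC₁ hgp h67 hLF h68 hα3 hα2 hsmall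
  have hre : (g k ^ 2)⁻¹ * ((L : ℝ) ^ k * ∑ y ∈ deltaBox (L ^ j) ((L ^ j : ℕ) • z₀) μ ν,
        (N : ℝ) * (1 - (N : ℝ)⁻¹ *
          (((hol U y (plaqWord μ ν) : (Matrix (Fin N) (Fin N) ℂ)ˣ) : Matrix (Fin N) (Fin N) ℂ).trace.re)))
      = (N : ℝ) * ((g k)⁻¹ ^ 2 * ∑ y ∈ deltaBox (L ^ j) ((L ^ j : ℕ) • z₀) μ ν,
        (L : ℝ) ^ k * (1 - (N : ℝ)⁻¹ *
          (((hol U y (plaqWord μ ν) : (Matrix (Fin N) (Fin N) ℂ)ˣ) : Matrix (Fin N) (Fin N) ℂ).trace.re))) := by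
    rw [Finset.mul_sum, Finset.mul_sum, Finset.mul_sum, Finset.mul_sum]
    refine Finset.sum_congr rfl fun y _ => ?_
    rw [inv_pow]
    ring
  rw [← hre]
  exact key

/-- **R-EPS0′ form of `perPlaquette71_local`:** the threshold from `g_j ≤ γ₇₁ᴸ(C₁, L, b₀, p₀)` (`Thresholds.gamma71L`).
[cite: Balaban1985UV3, (67)–(71) p.273] -/
theorem perPlaquette71_local_gamma (L : ℕ) (hL : 2 ≤ L) {gb ε b₀ p₀ C₁ : ℝ} (hgb : 0 < gb) (hε : 0 < ε) (hb₀ : 0 < b₀)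
    (hp₀ : 0 < p₀) (hC₁ : 0 < C₁) (g : ℕ → ℝ) (hrun : ∀ i, g i = B10.gRun gb L ε i) {j k : ℕ} (hjk : j ≤ k)
    (hγj : g j ≤ gamma71L C₁ L b₀ p₀)
    (U Vj : Site 3 → Fin 3 → (Matrix (Fin N) (Fin N) ℂ)ˣ) (hU : ∀ x κ, U x κ ∈ unitaryUnits (Matrix (Fin N) (Fin N) ℂ))
    (z₀ : Site 3) {μ ν : Fin 3} (hμν : μ ≠ ν)
    (h67 : hol (avgIter L U j) z₀ (plaqWord μ ν) = hol Vj z₀ (plaqWord μ ν))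
    (hLF : g j * B10.pFun b₀ p₀ (g j) ≤ ‖((hol Vj z₀ (plaqWord μ ν) : (Matrix (Fin N) (Fin N) ℂ)ˣ) : Matrix (Fin N) (Fin N) ℂ) - 1‖)
    (h68 : pdevOn (loK L j z₀) (plaqHiK L j z₀ μ ν) U < C₁ * (g j * B10.pFun b₀ p₀ (g j)) * (((L : ℝ) ^ j)⁻¹) ^ 2) :
    B10.pFun b₀ p₀ (g j) ^ 2 / 4 ≤
      (N : ℝ) * ((g k)⁻¹ ^ 2 * ∑ y ∈ deltaBox (L ^ j) ((L ^ j : ℕ) • z₀) μ ν,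
        (L : ℝ) ^ k * (1 - (N : ℝ)⁻¹ *
          (((hol U y (plaqWord μ ν) : (Matrix (Fin N) (Fin N) ℂ)ˣ) : Matrix (Fin N) (Fin N) ℂ).trace.re))) := by
  have hL1 : 1 ≤ L := le_trans (by norm_num) hL
  have hLr : (0 : ℝ) < L := by exact_mod_cast lt_of_lt_of_le (by norm_num) hL
  have hgj : 0 < g j := by rw [hrun]; exact B10.gRun_pos gb L ε hgb hLr hε j
  have hγ1 : g j ≤ 1 := hγj.trans (gamma71L_pos_le hC₁ hL1 hb₀ hp₀).2
  have hs := gamma71L_spec hC₁ hL1 hb₀ hp₀ hgj hγj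
  exact perPlaquette71_local L hL hgb hε hb₀ hC₁ g hrun hjk hγ1 hs le_rfl U Vj hU z₀ hμν h67 hLF h68

end LocalForm

end Summit.QuantumFields.Balaban3D.Proofs.PerPlaquette71

end
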